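import Mathlib
import Literature.NumberTheory.Transcendental.SemialgebraicLineDeriv
import Summits.KontsevichZagierPeriods.KontsevichZagierPeriods.Theorems.TorsionLogsNeronTorsionSectorStubTranslationStep
import Summits.KontsevichZagierPeriods.KontsevichZagierPeriods.Theorems.TorsionLogsNeronTorsionSectorStubSigmaChart
import Summits.KontsevichZagierPeriods.KontsevichZagierPeriods.Theorems.SymplecticScissorsRealOnePeriodRelationsStubArcSymbolsCut
import HarnessLib

/-!
# Stub `stub_cellStepZeroInst` — crux `TorsionLogs.NeronTorsionSector`, line `registered` (block S6)

The FIRST cell step of the Kontsevich–Zagier chain on the real torus of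
`y² = f(x) = 4x³ − g₂x − g₃`, out of the corner column: `c₁ ≡ c₀^mix + [(al, ar), (q₁ − q₀)/√f]`.

* Source: the MIXED-chart cell `Csrc = [(al, ar) × (0, s₁), ĥ(s′)·(√f x)⁻¹·(2/R s′)]`, the Haar
  variable `x ∈ (al, ar)` in the x-chart and the second-kind variable in the compactifying chart
  `s′ = x′^{-1/2}` of the corner row `(x₁, ∞)` (`ĥ(s) = (g₂s² + 2g₃s⁴)/4 = h(s⁻²)`,
  `R s = s³√f(s⁻²)`, `s₁² x₁ = 1`);
* target: the x-chart cell `Ctgt = [(al, ar) × (x₂, x₁), h(x′)/(√f x · √f x′)]`,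
  `h(x) = (g₂x + 2g₃)/(4x²)` the regular second-kind density;
* output: `rO = [(al, ar), (Q̂ s₁ − Q̂ 0)/√f x]`.

This is ONE application of the landed generic translation step `stub_translationStep` with
`φ = id` on `A = A′ = (al, ar)` (weights `w₀ = u₀ = (√f)⁻¹`), `ψ = τ̂ : (0, s₁) → (x₂, x₁)` (the
chart conjugate of the lower translation; source weight `w₁ = 2/R`, target weight `u₁ = (√f)⁻¹`,
chart Haar identity `|τ̂′|·R = 2√f∘τ̂`), kernels `kS = ĥ`, `kT = h` (both bounded by `Cb`), constant
fibres `(0, s₁)`, `J = [0, s₁]`, and the potential `Q = −Q̂`, whose derivative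
`Q̂′ = (h∘τ̂ − ĥ)·(2/R)` on `(0, s₁)` is the CHAIN RULE applied to the x-chart identity
`Qf′ = (h∘τ − h)/(−√f)` at `x = s⁻² > x₁` (`Q̂ = Qf∘(·)⁻²`, `τ̂ = τ∘(·)⁻²`, `√f(s⁻²) = R s/s³`,
`h(s⁻²) = ĥ s`, `d(s⁻²)/ds = −2/s³`).

References: M. Kontsevich, D. Zagier, *Periods* (2001), §1.2 rules (1)–(3); J. Bochnak, M. Coste,
M.-F. Roy, *Real Algebraic Geometry* (1998), §2.2, Prop. 2.2.6.
-/

noncomputable section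

-- `Summit.KontsevichZagierPeriods.KontsevichZagierPeriods.…` is the tree's mandated layout (single-conjunct summit).
set_option linter.dupNamespace false

open Set MeasureTheory MvPolynomial Filter Topology
open Literature.NumberTheory.Transcendental Literature.ModelTheory.ExponentialFields
open Summit.KontsevichZagierPeriods.SymplecticScissors.RealOnePeriodRelations.ArcSymbols
  (isSemialgebraic_IooDom)

namespace Summit.KontsevichZagierPeriods.KontsevichZagierPeriods.Cruxes.NeronTorsionSector.Translation

/-- **The second-kind density in the chart `x = s⁻²`**: `h(s⁻²) = (g₂s² + 2g₃s⁴)/4 = ĥ(s)` for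
`h(x) = (g₂x + 2g₃)/(4x²)`, `s ≠ 0`. [folklore] -/
theorem cellStepZero_hhat_eq {g₂ g₃ s : ℝ} (hs : s ≠ 0) :
    (g₂ * (s ^ 2)⁻¹ + 2 * g₃) / (4 * ((s ^ 2)⁻¹) ^ 2) = (g₂ * s ^ 2 + 2 * g₃ * s ^ 4) / 4 := by
  field_simp

/-- **Chain rule for the third-kind potential in the chart `s = x^{-1/2}` at the point at
infinity.** If `Q̂ s = Qf(s⁻²)`, `τ̂ s = τ(s⁻²)` and `√f(s⁻²) = R s / s³` on `(0, s₁]`, `s₁² x₁ = 1`,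
`R > 0` on `[0, s₁]`, and `Qf′ = (h∘τ − h)/(−√f)` on `(x₁, ∞)` (`h(x) = (g₂x + 2g₃)/(4x²)`), then on
`(0, s₁)` the chart potential satisfies `Q̂′ = (h∘τ̂ − ĥ)·(2/R)`, `ĥ(s) = (g₂s² + 2g₃s⁴)/4`
(`d(s⁻²)/ds = −2/s³`, `sigmaChart_hasDerivAt_inv_sq`). [cite: KontsevichZagier2001, §1.2 rule (2)] -/
theorem cellStepZero_hasDerivAt_chart {g₂ g₃ x₁ s₁ : ℝ} {f τ Qf R τh Qh : ℝ → ℝ}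
    (hsx : s₁ ^ 2 * x₁ = 1)
    (hchart : ∀ s, 0 < s → s ≤ s₁ →
      Real.sqrt (f (s ^ 2)⁻¹) = R s / s ^ 3 ∧ τh s = τ (s ^ 2)⁻¹ ∧ Qh s = Qf (s ^ 2)⁻¹)
    (hRpos : ∀ s ∈ Icc 0 s₁, 0 < R s)
    (hQfd : ∀ x, x₁ < x → HasDerivAt Qf
      (((g₂ * τ x + 2 * g₃) / (4 * τ x ^ 2) - (g₂ * x + 2 * g₃) / (4 * x ^ 2)) /
        (-Real.sqrt (f x))) x)
    {s : ℝ} (hs : s ∈ Ioo 0 s₁) :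
    HasDerivAt Qh (((g₂ * τh s + 2 * g₃) / (4 * τh s ^ 2) - (g₂ * s ^ 2 + 2 * g₃ * s ^ 4) / 4)
      * (2 / R s)) s := by
  have hs0 : 0 < s := hs.1
  have hx : x₁ < (s ^ 2)⁻¹ := sigmaChart_lt_inv_sq hsx hs0 hs.2
  obtain ⟨hsq, hτ, -⟩ := hchart s hs0 hs.2.le
  have hinner := sigmaChart_hasDerivAt_inv_sq hs0.ne'
  have hcomp := (hQfd _ hx).comp s hinner
  have hev : Qh =ᶠ[𝓝 s] (Qf ∘ fun y : ℝ => (y ^ 2)⁻¹) := by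
    filter_upwards [Ioo_mem_nhds hs.1 hs.2] with y hy
    exact (hchart y hy.1 hy.2.le).2.2
  refine (hcomp.congr_of_eventuallyEq hev).congr_deriv ?_
  have hR0 : R s ≠ 0 := (hRpos s ⟨hs0.le, hs.2.le⟩).ne'
  have hs0' : s ≠ 0 := hs0.ne'
  rw [← hτ, hsq, cellStepZero_hhat_eq hs0']
  generalize (g₂ * τh s + 2 * g₃) / (4 * τh s ^ 2) = K
  field_simp

/-- **The target cell is the image of the source cell under `Φ = id × τ̂`**: with
`τ̂((0, s₁)) = (x₂, x₁)`,
`{al < z₀ < ar, x₂ < z₁ < x₁} = (z ↦ (z₀, τ̂ z₁)) '' {al < z₀ < ar, 0 < z₁ < s₁}`. [folklore] -/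
theorem cellStepZero_image_domain {al ar s₁ x₁ x₂ : ℝ} {τh : ℝ → ℝ}
    (himg : τh '' Ioo 0 s₁ = Ioo x₂ x₁) :
    {z : Fin 2 → ℝ | (al < z 0 ∧ z 0 < ar) ∧ x₂ < z 1 ∧ z 1 < x₁} =
      (fun z : Fin 2 → ℝ => (![z 0, τh (z 1)] : Fin 2 → ℝ)) ''
        {z : Fin 2 → ℝ | (al < z 0 ∧ z 0 < ar) ∧ 0 < z 1 ∧ z 1 < s₁} := by
  ext w
  simp only [mem_setOf_eq, mem_image]
  constructor
  · rintro ⟨hw0, hw1⟩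
    have hw1' : w 1 ∈ τh '' Ioo 0 s₁ := by
      rw [himg]
      exact hw1
    obtain ⟨s, hs, hsw⟩ := hw1'
    refine ⟨![w 0, s], ⟨?_, ?_⟩, ?_⟩
    · simpa using hw0
    · simpa using hs
    · funext i
      fin_cases i
      · simp
      · simp [hsw]
  · rintro ⟨z, ⟨hz0, hz1⟩, rfl⟩
    have h1 : τh (z 1) ∈ Ioo x₂ x₁ := by
      rw [← himg]
      exact mem_image_of_mem τh hz1
    simpa using ⟨hz0, h1⟩

/-- **STUB S6 (`stub_cellStepZeroInst`) — the first cell step, out of the corner column: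
`c₁ ≡ c₀^mix + [(al,ar), (q₁ − q₀)/√f]`.** Source: the mixed-chart cell
`[(al,ar) × (0,s₁), ĥ(s′)·(1/√f x)(2/R s′)]` (x-chart in the Haar variable, chart `s′ = x′^{-1/2}` in
the second-kind variable), target the x-chart cell `[(al,ar) × (x₂,x₁), h(x′)/(√f√f′)]`; ONE
application of the landed `stub_translationStep` with `φ = id`, `ψ = τ̂ : (0,s₁) → (x₂,x₁)` (chart Haar
`|τ̂′|R = 2√f∘τ̂`), `w₀ = u₀ = u₁ = 1/√f`, `w₁ = 2/R`, `kS = ĥ`, `kT = h`, constant fibres `(0, s₁)`,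
potential `Q = −Q̂` (`Q̂′ = 2(h∘τ̂ − ĥ)/R` by the chain rule, `cellStepZero_hasDerivAt_chart`),
`Q̂ 0 = q₀`, `Q̂ s₁ = q₁`. [cite: KontsevichZagier2001, §1.2] -/
theorem stub_cellStepZeroInst :
    ∀ (g₂ g₃ e₁ al ar x₁ x₂ s₁ Cb : ℝ) (f τ Qf R τh τh' Qh : ℝ → ℝ)
      (Csrc Ctgt : Literature.NumberTheory.Transcendental.KZ.IntegralRep 2)
      (rO : Literature.NumberTheory.Transcendental.KZ.IntegralRep 1),
    (∀ x, f x = 4 * x ^ 3 - g₂ * x - g₃) → IsAlgebraic ℚ g₂ → IsAlgebraic ℚ g₃ →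
    IsAlgebraic ℚ al → IsAlgebraic ℚ ar → IsAlgebraic ℚ x₁ → IsAlgebraic ℚ x₂ → IsAlgebraic ℚ s₁ →
    0 < e₁ → e₁ < al → al < ar → e₁ < x₂ → x₂ < x₁ → 0 < s₁ → s₁ ^ 2 * x₁ = 1 → (∀ x, e₁ < x → 0 < f x) →
    (∀ x, e₁ < x → |(g₂ * x + 2 * g₃) / (4 * x ^ 2)| ≤ Cb) →
    MeasureTheory.IntegrableOn (fun t => (Real.sqrt (f t))⁻¹) (Set.Ioo al ar) →
    (∀ s, 0 < s → s ≤ s₁ → Real.sqrt (f (s ^ 2)⁻¹) = R s / s ^ 3 ∧ τh s = τ (s ^ 2)⁻¹ ∧ Qh s = Qf (s ^ 2)⁻¹) →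
    (∀ s ∈ Set.Icc 0 s₁, 0 < R s) → ContinuousOn R (Set.Icc 0 s₁) →
    IsSemialgebraicFunOn ℚ {t : Fin 1 → ℝ | t 0 ∈ Set.Icc 0 s₁} (fun t => R (t 0)) →
    (∀ s ∈ Set.Ioo 0 s₁, HasDerivAt τh (τh' s) s ∧ |τh' s| * R s = 2 * Real.sqrt (f (τh s)) ∧ τh s ∈ Set.Ioo x₂ x₁) →
    Set.InjOn τh (Set.Ioo 0 s₁) → τh '' Set.Ioo 0 s₁ = Set.Ioo x₂ x₁ →
    IsSemialgebraicFunOn ℚ {t : Fin 1 → ℝ | t 0 ∈ Set.Icc 0 s₁} (fun t => τh (t 0)) →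
    ContinuousOn Qh (Set.Icc 0 s₁) →
    IsSemialgebraicFunOn ℚ {t : Fin 1 → ℝ | t 0 ∈ Set.Icc 0 s₁} (fun t => Qh (t 0)) →
    (∀ x, x₁ < x → HasDerivAt Qf
      (((g₂ * τ x + 2 * g₃) / (4 * τ x ^ 2) - (g₂ * x + 2 * g₃) / (4 * x ^ 2)) / (-Real.sqrt (f x))) x) →
    Csrc.domain = {z | (al < z 0 ∧ z 0 < ar) ∧ 0 < z 1 ∧ z 1 < s₁} →
    Set.EqOn Csrc.integrand
      (fun z => (g₂ * (z 1) ^ 2 + 2 * g₃ * (z 1) ^ 4) / 4 * (Real.sqrt (f (z 0)))⁻¹ * (2 / R (z 1))) Csrc.domain →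
    Ctgt.domain = {z | (al < z 0 ∧ z 0 < ar) ∧ x₂ < z 1 ∧ z 1 < x₁} →
    Set.EqOn Ctgt.integrand
      (fun z => (g₂ * z 1 + 2 * g₃) / (4 * (z 1) ^ 2) / (Real.sqrt (f (z 0)) * Real.sqrt (f (z 1)))) Ctgt.domain →
    rO.domain = {t | al < t 0 ∧ t 0 < ar} →
    Set.EqOn rO.integrand (fun t => (Qh s₁ - Qh 0) / Real.sqrt (f (t 0))) rO.domain →
    Literature.NumberTheory.Transcendental.KZ.of Ctgt - Literature.NumberTheory.Transcendental.KZ.of Csrc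
      - Literature.NumberTheory.Transcendental.KZ.of rO ∈ Literature.NumberTheory.Transcendental.KZ.relations := by
  intro g₂ g₃ e₁ al ar x₁ x₂ s₁ Cb f τ Qf R τh τh' Qh Csrc Ctgt rO hf ag₂ ag₃ aal aar ax₁ ax₂ as₁ he₁ hal
    _halar hx₂ hx₂₁ hs₁ hsx hfpos hCb hint hchart hRpos hRc hRσ hτh hinj himg hτσ hQhc hQhσ hQfd hSd
    hSi hTd hTi hOd hOi
  /- ## Elementary facts on the four intervals -/
  have hsub : {t : Fin 1 → ℝ | t 0 ∈ Ioo (0 : ℝ) s₁} ⊆ {t : Fin 1 → ℝ | t 0 ∈ Icc (0 : ℝ) s₁} :=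
    fun t ht => Ioo_subset_Icc_self ht
  have hfA : ∀ x ∈ Ioo al ar, 0 < f x := fun x hx => hfpos x (hal.trans hx.1)
  have hfB' : ∀ x ∈ Ioo x₂ x₁, 0 < f x := fun x hx => hfpos x (hx₂.trans hx.1)
  have hRB : ∀ s ∈ Ioo (0 : ℝ) s₁, R s ≠ 0 := fun s hs => (hRpos s (Ioo_subset_Icc_self hs)).ne'
  have hB'0 : ∀ x ∈ Ioo x₂ x₁, x ≠ 0 := fun x hx => (he₁.trans (hx₂.trans hx.1)).ne'
  /- ## The `ℚ`-semialgebraic slabs over `A = A′ = (al, ar)`, `B = (0, s₁)`, `B′ = (x₂, x₁)`,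
  `J = [0, s₁]` (the landed `isSemialgebraic_IooDom`) -/
  have hA : IsSemialgebraic ℚ {t : Fin 1 → ℝ | t 0 ∈ Ioo al ar} :=
    isSemialgebraic_IooDom aal aar
  have hB : IsSemialgebraic ℚ {t : Fin 1 → ℝ | t 0 ∈ Ioo (0 : ℝ) s₁} :=
    isSemialgebraic_IooDom isAlgebraic_zero as₁
  have hB' : IsSemialgebraic ℚ {t : Fin 1 → ℝ | t 0 ∈ Ioo x₂ x₁} :=
    isSemialgebraic_IooDom ax₂ ax₁
  have hJ : IsSemialgebraic ℚ {t : Fin 1 → ℝ | t 0 ∈ Icc (0 : ℝ) s₁} :=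
    IsSemialgebraicFunOn.isSemialgebraic_holds hRσ
  -- constants and the coordinate function on a `ℚ`-semialgebraic slab
  have cst : ∀ {S : Set (Fin 1 → ℝ)} {c : ℝ}, IsSemialgebraic ℚ S → IsAlgebraic ℚ c →
      IsSemialgebraicFunOn ℚ S (fun _ => c) := fun hS hc =>
    isSemialgebraicFunOn_const_of_isAlgebraic hS hc
  have alg : ∀ n : ℕ, IsAlgebraic ℚ (n : ℝ) := fun n => isAlgebraic_nat n
  have crd : ∀ {S : Set (Fin 1 → ℝ)}, IsSemialgebraic ℚ S →
      IsSemialgebraicFunOn ℚ S (fun t => t 0) := fun hS =>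
    (isSemialgebraicFunOn_aeval hS (X 0 : MvPolynomial (Fin 1) ℚ)).congr fun x _ => by simp
  /- ## The hypotheses of `stub_translationStep` -/
  -- (6), (7): `φ = id`, `ψ = τ̂` are `ℚ`-semialgebraic
  have h6 : IsSemialgebraicFunOn ℚ {t : Fin 1 → ℝ | t 0 ∈ Ioo al ar} (fun t => t 0) := crd hA
  have h7 : IsSemialgebraicFunOn ℚ {t : Fin 1 → ℝ | t 0 ∈ Ioo (0 : ℝ) s₁} (fun t => τh (t 0)) :=
    hτσ.mono hsub hB
  -- (8), (10): `φ = id` is injective and maps `A` to `A′ = A`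
  have h8 : InjOn (fun x : ℝ => x) (Ioo al ar) := fun _ _ _ _ h => h
  have h10 : MapsTo (fun x : ℝ => x) (Ioo al ar) (Ioo al ar) := fun _ hx => hx
  -- (11): `τ̂` maps `(0, s₁)` into `(x₂, x₁)`
  have h11 : MapsTo τh (Ioo (0 : ℝ) s₁) (Ioo x₂ x₁) := fun s hs => (hτh s hs).2.2
  -- (12): derivative of `id` and the trivial Haar identity `u₀(x)·|1| = w₀(x)`
  have h12 : ∀ x ∈ Ioo al ar, HasDerivAt (fun x : ℝ => x) 1 x ∧
      (Real.sqrt (f x))⁻¹ * |(1 : ℝ)| = (Real.sqrt (f x))⁻¹ := fun x _ =>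
    ⟨hasDerivAt_id' x, by rw [abs_one, mul_one]⟩
  -- (13): derivative of `τ̂` and the chart Haar identity `(√f(τ̂ s))⁻¹·|τ̂′ s| = 2/R s`
  have h13 : ∀ s ∈ Ioo (0 : ℝ) s₁, HasDerivAt τh (τh' s) s ∧
      (Real.sqrt (f (τh s)))⁻¹ * |τh' s| = 2 / R s := fun s hs => by
    obtain ⟨hd, hhaar, hmem⟩ := hτh s hs
    refine ⟨hd, ?_⟩
    have h1 : Real.sqrt (f (τh s)) ≠ 0 := (Real.sqrt_pos.2 (hfB' _ hmem)).ne'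
    have h2 : R s ≠ 0 := hRB s hs
    rw [eq_div_iff h2, mul_assoc, hhaar]
    field_simp
  -- (14), (16), (17): the weights `(√f)⁻¹` on `A`, `A′`, `B′`
  have h14 : IsSemialgebraicFunOn ℚ {t : Fin 1 → ℝ | t 0 ∈ Ioo al ar}
      (fun t => (Real.sqrt (f (t 0)))⁻¹) :=
    (isSemialgebraicFunOn_sqrt_cubic_apply hA ag₂ ag₃ hf 0).inv fun t ht =>
      (Real.sqrt_pos.2 (hfA _ ht)).ne'
  have h17 : IsSemialgebraicFunOn ℚ {t : Fin 1 → ℝ | t 0 ∈ Ioo x₂ x₁}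
      (fun t => (Real.sqrt (f (t 0)))⁻¹) :=
    (isSemialgebraicFunOn_sqrt_cubic_apply hB' ag₂ ag₃ hf 0).inv fun t ht =>
      (Real.sqrt_pos.2 (hfB' _ ht)).ne'
  -- (15): the chart weight `2/R` on `B`
  have h15 : IsSemialgebraicFunOn ℚ {t : Fin 1 → ℝ | t 0 ∈ Ioo (0 : ℝ) s₁} (fun t => 2 / R (t 0)) :=
    (cst hB (alg 2)).div (hRσ.mono hsub hB) fun t ht => hRB _ ht
  -- (18): the chart kernel `ĥ(s) = (g₂s² + 2g₃s⁴)/4` on `B`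
  have h18 : IsSemialgebraicFunOn ℚ {t : Fin 1 → ℝ | t 0 ∈ Ioo (0 : ℝ) s₁}
      (fun t => (g₂ * (t 0) ^ 2 + 2 * g₃ * (t 0) ^ 4) / 4) :=
    (((cst hB ag₂).fun_mul ((crd hB).fun_pow 2)).fun_add
      (((cst hB (alg 2)).fun_mul (cst hB ag₃)).fun_mul ((crd hB).fun_pow 4))).div (cst hB (alg 4))
      fun _ _ => four_ne_zero
  -- (19): the kernel `h(x) = (g₂x + 2g₃)/(4x²)` on `B′`
  have h19 : IsSemialgebraicFunOn ℚ {t : Fin 1 → ℝ | t 0 ∈ Ioo x₂ x₁}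
      (fun t => (g₂ * t 0 + 2 * g₃) / (4 * (t 0) ^ 2)) :=
    (((cst hB' ag₂).fun_mul (crd hB')).fun_add ((cst hB' (alg 2)).fun_mul (cst hB' ag₃))).div
      ((cst hB' (alg 4)).fun_mul ((crd hB').fun_pow 2)) fun t ht =>
        mul_ne_zero four_ne_zero (pow_ne_zero 2 (hB'0 _ ht))
  -- (20): `|ĥ| ≤ Cb` on `B` (`ĥ s = h(s⁻²)` with `s⁻² > x₁ > e₁`)
  have h20 : ∀ s ∈ Ioo (0 : ℝ) s₁, |(g₂ * s ^ 2 + 2 * g₃ * s ^ 4) / 4| ≤ Cb := fun s hs => by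
    have hx : x₁ < (s ^ 2)⁻¹ := sigmaChart_lt_inv_sq hsx hs.1 hs.2
    have h := hCb _ (hx₂.trans (hx₂₁.trans hx))
    rwa [cellStepZero_hhat_eq hs.1.ne'] at h
  -- (21): `|h| ≤ Cb` on `B′`
  have h21 : ∀ x ∈ Ioo x₂ x₁, |(g₂ * x + 2 * g₃) / (4 * x ^ 2)| ≤ Cb := fun x hx =>
    hCb x (hx₂.trans hx.1)
  -- (22), (23): the source weights are non-negative
  have h22 : ∀ x ∈ Ioo al ar, 0 ≤ (Real.sqrt (f x))⁻¹ := fun x _ =>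
    inv_nonneg.2 (Real.sqrt_nonneg _)
  have h23 : ∀ s ∈ Ioo (0 : ℝ) s₁, 0 ≤ 2 / R s := fun s hs =>
    div_nonneg zero_le_two (hRpos s (Ioo_subset_Icc_self hs)).le
  -- (25): `2/R` is integrable on `(0, s₁)` (continuous on the compact `[0, s₁]`, `R > 0`)
  have h25 : IntegrableOn (fun s => 2 / R s) (Ioo (0 : ℝ) s₁) := by
    have hc : ContinuousOn (fun s => 2 / R s) (Icc (0 : ℝ) s₁) :=
      continuousOn_const.div hRc fun s hs => (hRpos s hs).ne'
    exact hc.integrableOn_Icc.mono_set Ioo_subset_Icc_self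
  -- (26), (27): the constant fibre ends `0`, `s₁`
  have h26 : IsSemialgebraicFunOn ℚ {t : Fin 1 → ℝ | t 0 ∈ Ioo al ar} (fun _ => (0 : ℝ)) :=
    cst hA isAlgebraic_zero
  have h27 : IsSemialgebraicFunOn ℚ {t : Fin 1 → ℝ | t 0 ∈ Ioo al ar} (fun _ => s₁) := cst hA as₁
  have h28 : ∀ x ∈ Ioo al ar, (0 : ℝ) < s₁ := fun _ _ => hs₁
  have h29 : ∀ x ∈ Ioo al ar, Icc (0 : ℝ) s₁ ⊆ Icc (0 : ℝ) s₁ := fun _ _ => Subset.rfl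
  have h30 : ∀ x ∈ Ioo al ar, Ioo (0 : ℝ) s₁ ⊆ Ioo (0 : ℝ) s₁ := fun _ _ => Subset.rfl
  -- (31), (32), (33): the potential `Q = −Q̂` on `J = [0, s₁]`
  have h31 : IsSemialgebraicFunOn ℚ {t : Fin 1 → ℝ | t 0 ∈ Icc (0 : ℝ) s₁} (fun t => -Qh (t 0)) :=
    hQhσ.fun_neg
  have h32 : ∀ x ∈ Ioo al ar, ContinuousOn (fun s => -Qh s) (Icc (0 : ℝ) s₁) := fun _ _ => hQhc.neg
  have h33 : ∀ x ∈ Ioo al ar, ∀ s ∈ Ioo (0 : ℝ) s₁, HasDerivAt (fun s => -Qh s)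
      (-(((g₂ * τh s + 2 * g₃) / (4 * τh s ^ 2) - (g₂ * s ^ 2 + 2 * g₃ * s ^ 4) / 4)
        * (2 / R s))) s := fun _ _ s hs =>
    (cellStepZero_hasDerivAt_chart hsx hchart hRpos hQfd hs).neg
  -- (34)–(39): the three representations
  have h34 : Csrc.domain = {z | z 0 ∈ Ioo al ar ∧ (0 : ℝ) < z 1 ∧ z 1 < s₁} := by
    rw [hSd]
    rfl
  have h36 : Ctgt.domain =
      (fun z : Fin 2 → ℝ => (![z 0, τh (z 1)] : Fin 2 → ℝ)) '' Csrc.domain := by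
    rw [hTd, hSd]
    exact cellStepZero_image_domain himg
  have h37 : EqOn Ctgt.integrand (fun z => (g₂ * z 1 + 2 * g₃) / (4 * (z 1) ^ 2)
      * (Real.sqrt (f (z 0)))⁻¹ * (Real.sqrt (f (z 1)))⁻¹) Ctgt.domain := fun z hz => by
    rw [hTi hz]
    ring
  have h38 : rO.domain = {t | t 0 ∈ Ioo al ar} := by
    rw [hOd]
    rfl
  have h39 : EqOn rO.integrand (fun t => (-Qh 0 - -Qh s₁) * (Real.sqrt (f (t 0)))⁻¹)
      rO.domain := fun t ht => by
    rw [hOi ht]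
    ring
  /- ## One application of the translation step -/
  exact stub_translationStep (fun x => x) (fun _ => 1) τh τh'
    (fun s => (g₂ * s ^ 2 + 2 * g₃ * s ^ 4) / 4) (fun x => (g₂ * x + 2 * g₃) / (4 * x ^ 2))
    (fun x => (Real.sqrt (f x))⁻¹) (fun s => 2 / R s) (fun x => (Real.sqrt (f x))⁻¹)
    (fun x => (Real.sqrt (f x))⁻¹) (fun s => -Qh s) (fun _ => 0) (fun _ => s₁)
    (Ioo al ar) (Ioo 0 s₁) (Ioo al ar) (Ioo x₂ x₁) (Icc 0 s₁) Cb Csrc Ctgt rO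
    hA hB hA hB' hJ h6 h7 h8 hinj h10 h11 h12 h13 h14 h15 h14 h17 h18 h19 h20 h21 h22 h23 hint h25
    h26 h27 h28 h29 h30 h31 h32 h33 h34 hSi h36 h37 h38 h39

end Summit.KontsevichZagierPeriods.KontsevichZagierPeriods.Cruxes.NeronTorsionSector.Translation

end
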